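import Literature.NumberTheory.Automorphic.UnitaryGroupBorelLatticeCellCount
import HarnessLib

/-!
# The cell count on a Siegel set: `#R(b k) · ν(𝓕) ≤ C₀ · δ_B(b)` when the unipotent part of `b`
# and the root values of its torus part stay in compacta
(Rogawski, *Automorphic Representations of Unitary Groups in Three Variables* (1990), §2.2, p. 13;
Arthur, *A trace formula for reductive groups I*, Duke Math. J. 45 (1978), §5: on a Siegel set the
number of rational Borel elements meeting a compact set is `O(δ_B)`)

Topic `NumberTheory/Automorphic`; namespace `Literature.NumberTheory.Automorphic.UnitaryGroup`. THEOREMS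
ONLY over accepted tree modules: no definition, no named fact, no `sorry`, no instance, no notation.
This is brick H4-d («Siegel-coordinate compactness») of the cell road to the integrability of Arthur's
truncated kernel `k^T` on `U(3)` (★ `UnitaryGroupTruncatedKernelCellBound`: `‖k^T(g)‖ ≤ #R(g) · ε`;
★ `UnitaryGroupBorelLatticeCellCount`: `#R(x) · ν(𝓕) ≤ Σ_t ν(A_t(x) · U⁻¹ 𝓕)` and, at `x = b k`,
`ν(A_t(b k) · W) ≤ δ_B(b) · ν(A_t(k) · b⁻¹ W b)`). What remains is to keep `b⁻¹ W b` inside ONE compact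
set of `N(𝔸_F)`: false over all of `B(𝔸_F)` (a far-out `n₀ ∈ N(𝔸_F)` shears `W` along the centre), true
on a Siegel set, where the unipotent part of `b` ranges in a compact set and the torus part CONTRACTS
`N(𝔸_F)` — in the Heisenberg chart the torus `diag(d₀, d₁, d₂)` acts by `x ↦ d₀⁻¹ d₁ x`, `y ↦ d₀⁻¹ d₂ y`
(★ `heisX_conjBy`, ★ `coe_heisY_conjBy`), so it suffices that the ROOT VALUES `d₀⁻¹ d₁`, `d₀⁻¹ d₂` lie in
fixed compact subsets `R₁, R₂ ⊆ 𝔸_E`.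

* §1 `coordX_torusConj`, `coe_coordY_torusConj` — `x(t⁻¹ w t) = d₀⁻¹ d₁ · x(w)`, `y(t⁻¹ w t) = d₀⁻¹ d₂ · y(w)`
  on the tree's `N(𝔸_F) = adelicUnipotent F E c 3` (transport of ★ `heisX_conjBy` ∕ ★ `coe_heisY_conjBy`).
* §2 `exists_isCompact_torusConj_mem` — for compact `W ⊆ N(𝔸_F)`, `R₁, R₂ ⊆ 𝔸_E` a compact `W'` with
  `t⁻¹ W t ⊆ W'` for every `t ∈ T(𝔸_F)` whose root values lie in `R₁, R₂` (★ `isClosed_traceZeroAdele`).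
* §3 `exists_isCompact_borelConj_image_subset` — the same for `b ∈ B(𝔸_F)` whose unipotent part
  `(torusPart b)⁻¹ b` (★ `torusPart_inv_mul_mem_adelicUnipotent`) lies in a compact `Ω ⊆ G(𝔸_F)`.
* §4 (every `N`) `finite_setOf_rationalTorus_conj_mem_of_isCompact` — only finitely many `t ∈ T(F)` have
  `x⁻¹ t m y ∈ C` for some `x ∈ C_x`, `y ∈ C_y`, `m ∈ N(𝔸_F)` (set version of ★
  `finite_setOf_rationalTorus_meets_support_of_isCompact`).
* §5 (`N = 3`) **`exists_forall_card_mul_measure_le_mul_torusRootModulus`** — THE COUNT ON A SIEGEL SET: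
  `∃ C₀ : ℝ≥0`, `#R · ν(𝓕) ≤ C₀ · δ_B(b)` for every `b ∈ B(𝔸_F)` with unipotent part in `Ω` and root values
  in `R₁, R₂`, every `k ∈ K` and every finite `R ⊆ B(F)` with `(b k)⁻¹ β (y · b k) ∈ C`, `y ∈ U` (the shape
  of ★ `exists_finset_truncatedKernel`, `C = tsupport f`, `U = {1} ∪ U_f`). Neither a fundamental domain
  of `T(F)` nor the Iwasawa decomposition enters: the consumer (brick H8) supplies `Ω, R₁, R₂`.

## References

* J. D. Rogawski, *Automorphic Representations of Unitary Groups in Three Variables*, Annals of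
  Mathematics Studies 123 (1990), §2.2 (p. 13) [Rogawski1990].
* J. Arthur, *A trace formula for reductive groups I: terms associated to classes in `G(ℚ)`*, Duke
  Math. J. 45 (1978), §5 [Arthur1978TraceFormulaI].
-/

set_option autoImplicit false

noncomputable section

open MeasureTheory NumberField IsDedekindDomain Topology Set
open scoped NNReal ENNReal MatrixGroups Pointwise

namespace Literature.NumberTheory.Automorphic

namespace UnitaryGroup

variable {F E : Type} [Field F] [NumberField F] [Field E] [NumberField E] [Algebra F E]
  {c : E ≃ₐ[F] E} {N : ℕ}

/-! ## §0 Plumbing: `𝔸_E` Hausdorff, `N(𝔸_F)` closed -/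

omit [NumberField F] [Algebra F E] in
/-- `𝔸_E` is Hausdorff (local copy of the standard three-line argument). [folklore] -/
private theorem t2Space_adeleRing_E₉ : T2Space (AdeleRing (𝓞 E) E) := by
  haveI : T2Space (FiniteAdeleRing (𝓞 E) E) := inferInstanceAs <| T2Space
    (RestrictedProduct (fun w : HeightOneSpectrum (𝓞 E) => w.adicCompletion E)
      (fun w => (w.adicCompletionIntegers E : Set (w.adicCompletion E))) Filter.cofinite)
  haveI : T2Space (InfiniteAdeleRing E) :=
    inferInstanceAs <| T2Space ((w : InfinitePlace E) → w.Completion)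
  exact inferInstanceAs <| T2Space (InfiniteAdeleRing E × FiniteAdeleRing (𝓞 E) E)

/-- `N(𝔸_F)` is closed in `G(𝔸_F)` (plumbing, as in `UnitaryGroupKernelBorelTorusFibration`). [folklore] -/
private theorem isClosed_adelicUnipotent₉ :
    IsClosed ((adelicUnipotent F E c N : Set (quasiSplit F E c N).Adelic)) := by
  haveI := t2Space_adeleRing_E₉ (E := E)
  change IsClosed (⇑(adelicVal F E c N ((StdForm.antidiagonal N).over E)) ⁻¹'
    ((upperUnitriangular (Fin N) (AdeleRing (𝓞 E) E) : Subgroup (GL (Fin N) (AdeleRing (𝓞 E) E))) :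
      Set (GL (Fin N) (AdeleRing (𝓞 E) E))))
  exact (isClosed_upperUnitriangular (R := AdeleRing (𝓞 E) E)).preimage continuous_subtype_val

/-- The preimage in `N(𝔸_F)` of a compact set of `G(𝔸_F)` is compact (`N(𝔸_F)` is closed). [folklore] -/
private theorem isCompact_preimage_coe_adelicUnipotent {K : Set (quasiSplit F E c N).Adelic}
    (hK : IsCompact K) :
    IsCompact ((fun m : adelicUnipotent F E c N => (m : (quasiSplit F E c N).Adelic)) ⁻¹' K) :=
  (isClosed_adelicUnipotent₉ (F := F) (E := E) (c := c) (N := N)).isClosedEmbedding_subtypeVal.isCompact_preimage hK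

/-! ## §1 The torus acts on the Heisenberg chart of `adelicUnipotent F E c 3` by its root values -/

/-- For `t ∈ T(𝔸_F)` the diagonal matrix of its diagonal entries is `t` itself:
`glDiagonal (diagUnit t) = adelicVal t` (★ `torusPart_eq_self_of_mem`, ★ `adelicVal_torusPart`).
[cite: Rogawski1990, §1.10] -/
theorem glDiagonal_diagUnit_of_mem_torusAdelic {t : (quasiSplit F E c N).Adelic}
    (ht : t ∈ torusAdelic F E c N) :
    glDiagonal N (AdeleRing (𝓞 E) E) (diagUnit (torusAdelic_le_borelAdelic ht)) =
      adelicVal F E c N _ t := by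
  have h := adelicVal_torusPart (⟨t, torusAdelic_le_borelAdelic ht⟩ : borelAdelic F E c N)
  rw [torusPart_eq_self_of_mem (b := (⟨t, torusAdelic_le_borelAdelic ht⟩ : borelAdelic F E c N)) ht] at h
  exact h.symm

/-- **`x(t⁻¹ w t) = d₀⁻¹ d₁ · x(w)`** on `N(𝔸_F) = adelicUnipotent F E c 3`, for `t ∈ T(𝔸_F)` with
diagonal `d` (transport of ★ `heisX_conjBy` along ★ `unipToBorel`). [cite: Rogawski1990, §1.10] -/
theorem coordX_torusConj {t : (quasiSplit F E c 3).Adelic} (ht : t ∈ torusAdelic F E c 3)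
    {d : Fin 3 → (AdeleRing (𝓞 E) E)ˣ} (hd : glDiagonal 3 (AdeleRing (𝓞 E) E) d = adelicVal F E c 3 _ t)
    (w : adelicUnipotent F E c 3) :
    coordX (⟨t⁻¹ * (w : (quasiSplit F E c 3).Adelic) * t,
        conj_mem_adelicUnipotent (torusAdelic_le_borelAdelic ht) w.2⟩ : adelicUnipotent F E c 3) =
      (((d 0)⁻¹ * d 1 : (AdeleRing (𝓞 E) E)ˣ) : AdeleRing (𝓞 E) E) * coordX w := by
  set tB : torusInBorel F E c 3 :=
    ⟨⟨t, torusAdelic_le_borelAdelic ht⟩, (mem_torusInBorel_iff _).2 ht⟩ with htB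
  have hd' : glDiagonal 3 (AdeleRing (𝓞 E) E) d =
      adelicVal F E c 3 _ (((tB : torusInBorel F E c 3) : borelAdelic F E c 3) : (quasiSplit F E c 3).Adelic) := hd
  have key := heisX_conjBy tB hd' (unipToBorel F E c w)
  have hconj : unipToBorel F E c (⟨t⁻¹ * (w : (quasiSplit F E c 3).Adelic) * t,
      conj_mem_adelicUnipotent (torusAdelic_le_borelAdelic ht) w.2⟩ : adelicUnipotent F E c 3) =
      isTopSemidirect_borelAdelic.conjBy tB (unipToBorel F E c w) :=
    Subtype.ext (Subtype.ext rfl)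
  change heisX (unipToBorel F E c _) = _ * heisX (unipToBorel F E c w)
  rw [hconj, key]

/-- **`y(t⁻¹ w t) = d₀⁻¹ d₂ · y(w)`** on `N(𝔸_F) = adelicUnipotent F E c 3` (as adeles), for
`t ∈ T(𝔸_F)` with diagonal `d` (transport of ★ `coe_heisY_conjBy`). [cite: Rogawski1990, §1.10] -/
theorem coe_coordY_torusConj (hc : c * c = 1) {t : (quasiSplit F E c 3).Adelic} (ht : t ∈ torusAdelic F E c 3)
    {d : Fin 3 → (AdeleRing (𝓞 E) E)ˣ} (hd : glDiagonal 3 (AdeleRing (𝓞 E) E) d = adelicVal F E c 3 _ t)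
    (w : adelicUnipotent F E c 3) :
    (coordY hc (⟨t⁻¹ * (w : (quasiSplit F E c 3).Adelic) * t,
        conj_mem_adelicUnipotent (torusAdelic_le_borelAdelic ht) w.2⟩ : adelicUnipotent F E c 3) :
        AdeleRing (𝓞 E) E) =
      (((d 0)⁻¹ * d 2 : (AdeleRing (𝓞 E) E)ˣ) : AdeleRing (𝓞 E) E) * (coordY hc w : AdeleRing (𝓞 E) E) := by
  set tB : torusInBorel F E c 3 :=
    ⟨⟨t, torusAdelic_le_borelAdelic ht⟩, (mem_torusInBorel_iff _).2 ht⟩ with htB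
  have hd' : glDiagonal 3 (AdeleRing (𝓞 E) E) d =
      adelicVal F E c 3 _ (((tB : torusInBorel F E c 3) : borelAdelic F E c 3) : (quasiSplit F E c 3).Adelic) := hd
  have key := coe_heisY_conjBy hc tB hd' (unipToBorel F E c w)
  have hconj : unipToBorel F E c (⟨t⁻¹ * (w : (quasiSplit F E c 3).Adelic) * t,
      conj_mem_adelicUnipotent (torusAdelic_le_borelAdelic ht) w.2⟩ : adelicUnipotent F E c 3) =
      isTopSemidirect_borelAdelic.conjBy tB (unipToBorel F E c w) :=
    Subtype.ext (Subtype.ext rfl)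
  change ((heisY hc (unipToBorel F E c _) : traceZeroAdele F E c) : AdeleRing (𝓞 E) E) =
    _ * ((heisY hc (unipToBorel F E c w) : traceZeroAdele F E c) : AdeleRing (𝓞 E) E)
  rw [hconj, key]

/-! ## §2 Torus conjugation keeps a compact set in a compact set when the root values stay in compacta -/

/-- **TORUS CONTRACTION IN THE HEISENBERG CHART.** For compact `W ⊆ N(𝔸_F)`, `R₁, R₂ ⊆ 𝔸_E` there is
a compact `W' ⊆ N(𝔸_F)` (`= chart(R₁ · x(W) × (R₂ · y(W) ∩ 𝔸_E⁻))`) with `t⁻¹ w t ∈ W'` for every `w ∈ W`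
and every `t ∈ T(𝔸_F)` whose root values `d₀⁻¹ d₁`, `d₀⁻¹ d₂` lie in `R₁`, `R₂` (§1; Rogawski (1990), §2.2:
on a Siegel set `a⁻¹ ω a` stays in a compact set). [cite: Rogawski1990, §2.2 (p. 13)] -/
theorem exists_isCompact_torusConj_mem (hc : c * c = 1) {W : Set (adelicUnipotent F E c 3)}
    (hW : IsCompact W) {R₁ R₂ : Set (AdeleRing (𝓞 E) E)} (hR₁ : IsCompact R₁) (hR₂ : IsCompact R₂) :
    ∃ W' : Set (adelicUnipotent F E c 3), IsCompact W' ∧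
      ∀ (t : (quasiSplit F E c 3).Adelic) (ht : t ∈ torusAdelic F E c 3)
        (d : Fin 3 → (AdeleRing (𝓞 E) E)ˣ), glDiagonal 3 (AdeleRing (𝓞 E) E) d = adelicVal F E c 3 _ t →
        (((d 0)⁻¹ * d 1 : (AdeleRing (𝓞 E) E)ˣ) : AdeleRing (𝓞 E) E) ∈ R₁ →
        (((d 0)⁻¹ * d 2 : (AdeleRing (𝓞 E) E)ˣ) : AdeleRing (𝓞 E) E) ∈ R₂ →
        ∀ w ∈ W, (⟨t⁻¹ * (w : (quasiSplit F E c 3).Adelic) * t,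
          conj_mem_adelicUnipotent (torusAdelic_le_borelAdelic ht) w.2⟩ : adelicUnipotent F E c 3) ∈ W' := by
  -- the compact coordinate ranges
  have hX : IsCompact (coordX '' W) :=
    hW.image (continuous_heisX.comp continuous_unipToBorel)
  have hY : IsCompact ((Subtype.val : traceZeroAdele F E c → AdeleRing (𝓞 E) E) '' (coordY hc '' W)) :=
    (hW.image ((continuous_heisY hc).comp continuous_unipToBorel)).image continuous_subtype_val
  set KX : Set (AdeleRing (𝓞 E) E) :=
    (fun p : AdeleRing (𝓞 E) E × AdeleRing (𝓞 E) E => p.1 * p.2) '' (R₁ ×ˢ (coordX '' W)) with hKX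
  have hKXc : IsCompact KX := (hR₁.prod hX).image (continuous_fst.mul continuous_snd)
  set KY₀ : Set (AdeleRing (𝓞 E) E) :=
    (fun p : AdeleRing (𝓞 E) E × AdeleRing (𝓞 E) E => p.1 * p.2) ''
      (R₂ ×ˢ ((Subtype.val : traceZeroAdele F E c → AdeleRing (𝓞 E) E) '' (coordY hc '' W))) with hKY₀
  have hKY₀c : IsCompact KY₀ := (hR₂.prod hY).image (continuous_fst.mul continuous_snd)
  set KY : Set (traceZeroAdele F E c) :=
    (Subtype.val : traceZeroAdele F E c → AdeleRing (𝓞 E) E) ⁻¹' KY₀ with hKY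
  have hKYc : IsCompact KY :=
    (isClosed_traceZeroAdele (F := F) (E := E) (c := c)).isClosedEmbedding_subtypeVal.isCompact_preimage hKY₀c
  refine ⟨heisChart hc '' (KX ×ˢ KY), (hKXc.prod hKYc).image (heisChart hc).continuous,
    fun t ht d hd h₁ h₂ w hw => ?_⟩
  set u : adelicUnipotent F E c 3 := ⟨t⁻¹ * (w : (quasiSplit F E c 3).Adelic) * t,
    conj_mem_adelicUnipotent (torusAdelic_le_borelAdelic ht) w.2⟩ with hu
  rw [← heisChart_coord hc u]
  refine Set.mem_image_of_mem _ (Set.mk_mem_prod ?_ ?_)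
  · -- `x(u) = d₀⁻¹ d₁ · x(w) ∈ R₁ · x(W)`
    rw [hu, coordX_torusConj ht hd w]
    exact ⟨(_, coordX w), Set.mk_mem_prod h₁ (Set.mem_image_of_mem _ hw), rfl⟩
  · -- `y(u) = d₀⁻¹ d₂ · y(w) ∈ R₂ · y(W)`
    change ((coordY hc u : traceZeroAdele F E c) : AdeleRing (𝓞 E) E) ∈ KY₀
    rw [hu, coe_coordY_torusConj hc ht hd w]
    exact ⟨(_, ((coordY hc w : traceZeroAdele F E c) : AdeleRing (𝓞 E) E)),
      Set.mk_mem_prod h₂ (Set.mem_image_of_mem _ (Set.mem_image_of_mem _ hw)), rfl⟩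

/-! ## §3 Conjugation by `b ∈ B(𝔸_F)` with unipotent part in a compact and root values in compacta -/

/-- **`b⁻¹ W b` STAYS IN ONE COMPACT SET ON A SIEGEL SET.** For compact `W ⊆ N(𝔸_F)`, `Ω ⊆ G(𝔸_F)` and
`R₁, R₂ ⊆ 𝔸_E` there is a compact `W' ⊆ N(𝔸_F)` with `b⁻¹ W b ⊆ W'` for every `b ∈ B(𝔸_F)` whose
unipotent part `n₀ = (torusPart b)⁻¹ b` lies in `Ω` and whose root values `d₀⁻¹ d₁`, `d₀⁻¹ d₂`
(`d = diagUnit b`) lie in `R₁`, `R₂`: `b⁻¹ w b = n₀⁻¹ (t⁻¹ w t) n₀`, `t = torusPart b` (§2). [cite: Rogawski1990, §2.2 (p. 13)] -/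
theorem exists_isCompact_borelConj_image_subset (hc : c * c = 1) {W : Set (adelicUnipotent F E c 3)}
    (hW : IsCompact W) {Ω : Set (quasiSplit F E c 3).Adelic} (hΩ : IsCompact Ω)
    {R₁ R₂ : Set (AdeleRing (𝓞 E) E)} (hR₁ : IsCompact R₁) (hR₂ : IsCompact R₂) :
    ∃ W' : Set (adelicUnipotent F E c 3), IsCompact W' ∧
      ∀ b : borelAdelic F E c 3,
        (((torusPart b)⁻¹ * b : borelAdelic F E c 3) : (quasiSplit F E c 3).Adelic) ∈ Ω →
        (((diagUnit b.2 0)⁻¹ * diagUnit b.2 1 : (AdeleRing (𝓞 E) E)ˣ) : AdeleRing (𝓞 E) E) ∈ R₁ →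
        (((diagUnit b.2 0)⁻¹ * diagUnit b.2 2 : (AdeleRing (𝓞 E) E)ˣ) : AdeleRing (𝓞 E) E) ∈ R₂ →
        (fun w : adelicUnipotent F E c 3 =>
          (⟨(b : (quasiSplit F E c 3).Adelic)⁻¹ * (w : (quasiSplit F E c 3).Adelic) * (b : (quasiSplit F E c 3).Adelic),
            conj_mem_adelicUnipotent b.2 w.2⟩ : adelicUnipotent F E c 3)) '' W ⊆ W' := by
  obtain ⟨W₁, hW₁, hW₁mem⟩ := exists_isCompact_torusConj_mem hc hW hR₁ hR₂
  -- the compact set `Ω⁻¹ W₁ Ω ⊆ G(𝔸_F)` pulled back to `N(𝔸_F)`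
  set W₂ : Set (quasiSplit F E c 3).Adelic :=
    (fun p : (quasiSplit F E c 3).Adelic × (quasiSplit F E c 3).Adelic => p.1⁻¹ * p.2 * p.1) ''
      (Ω ×ˢ ((fun m : adelicUnipotent F E c 3 => (m : (quasiSplit F E c 3).Adelic)) '' W₁)) with hW₂
  have hW₂c : IsCompact W₂ :=
    (hΩ.prod (hW₁.image continuous_subtype_val)).image
      ((continuous_fst.inv.mul continuous_snd).mul continuous_fst)
  refine ⟨(fun m : adelicUnipotent F E c 3 => (m : (quasiSplit F E c 3).Adelic)) ⁻¹' W₂,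
    isCompact_preimage_coe_adelicUnipotent hW₂c, fun b hΩb h₁ h₂ => ?_⟩
  rintro _ ⟨w, hw, rfl⟩
  -- `t = torusPart b`, `n₀ = t⁻¹ b`
  have ht : (((torusPart b : borelAdelic F E c 3)) : (quasiSplit F E c 3).Adelic) ∈ torusAdelic F E c 3 :=
    torusPart_mem_torusAdelic b
  have hd : glDiagonal 3 (AdeleRing (𝓞 E) E) (diagUnit b.2) =
      adelicVal F E c 3 _ (((torusPart b : borelAdelic F E c 3)) : (quasiSplit F E c 3).Adelic) :=
    (adelicVal_torusPart b).symm
  have hmem := hW₁mem _ ht (diagUnit b.2) hd h₁ h₂ w hw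
  refine ⟨((((torusPart b)⁻¹ * b : borelAdelic F E c 3) : (quasiSplit F E c 3).Adelic), _),
    Set.mk_mem_prod hΩb (Set.mem_image_of_mem _ hmem), ?_⟩
  change ((((torusPart b)⁻¹ * b : borelAdelic F E c 3) : (quasiSplit F E c 3).Adelic))⁻¹ *
      ((((torusPart b : borelAdelic F E c 3)) : (quasiSplit F E c 3).Adelic)⁻¹ *
        (w : (quasiSplit F E c 3).Adelic) * (((torusPart b : borelAdelic F E c 3)) : (quasiSplit F E c 3).Adelic)) *
      ((((torusPart b)⁻¹ * b : borelAdelic F E c 3) : (quasiSplit F E c 3).Adelic)) =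
    (b : (quasiSplit F E c 3).Adelic)⁻¹ * (w : (quasiSplit F E c 3).Adelic) * (b : (quasiSplit F E c 3).Adelic)
  rw [Subgroup.coe_mul, Subgroup.coe_inv]
  group

/-! ## §4 Only finitely many rational torus fibres meet a compact set, uniformly on compacta -/

/-- **Only finitely many torus fibres meet a compact set, uniformly on compacta** (set version of
★ `finite_setOf_rationalTorus_meets_support_of_isCompact`): for compact `C, C_x, C_y ⊆ G(𝔸_F)` the set of
`t ∈ T(F)` with `x⁻¹ t m y ∈ C` for some `x ∈ C_x`, `y ∈ C_y`, `m ∈ N(𝔸_F)` is finite — such `t` are the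
torus parts (★ `torusPart`, continuous) of the compact `B(𝔸_F) ∩ C_x · C · C_y⁻¹` (`B(𝔸_F)` is closed,
★ `isClosed_borelAdelic`) and lie in the discrete `G(F)` (★ `finite_setOf_mem_arithmeticSubgroup_of_isCompact`).
[cite: Rogawski1990, §2.2 (p. 13)] -/
theorem finite_setOf_rationalTorus_conj_mem_of_isCompact {C : Set (quasiSplit F E c N).Adelic}
    (hCc : IsCompact C) {Cx Cy : Set (quasiSplit F E c N).Adelic} (hCx : IsCompact Cx)
    (hCy : IsCompact Cy) :
    {t : rationalTorus F E c N | ∃ x ∈ Cx, ∃ y ∈ Cy, ∃ m : adelicUnipotent F E c N,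
      x⁻¹ * ((t : torusAdelic F E c N) : (quasiSplit F E c N).Adelic) *
        ((m : adelicUnipotent F E c N) : (quasiSplit F E c N).Adelic) * y ∈ C}.Finite := by
  -- the compact set `C_x · C · C_y⁻¹` and the torus parts of its trace on `B(𝔸_F)`
  set K : Set (quasiSplit F E c N).Adelic :=
    (fun p : ((quasiSplit F E c N).Adelic × (quasiSplit F E c N).Adelic) × (quasiSplit F E c N).Adelic =>
      p.1.1 * p.2 * p.1.2⁻¹) '' ((Cx ×ˢ Cy) ×ˢ C) with hK
  have hKc : IsCompact K :=
    ((hCx.prod hCy).prod hCc).image (by fun_prop)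
  have hKB : IsCompact ((Subtype.val : borelAdelic F E c N → (quasiSplit F E c N).Adelic) ⁻¹' K) :=
    isClosed_borelAdelic.isClosedEmbedding_subtypeVal.isCompact_preimage hKc
  have hC : IsCompact ((Subtype.val : borelAdelic F E c N → (quasiSplit F E c N).Adelic) ''
      (torusPart '' ((Subtype.val : borelAdelic F E c N → (quasiSplit F E c N).Adelic) ⁻¹' K))) :=
    (hKB.image continuous_torusPart).image continuous_subtype_val
  have hfin := finite_setOf_mem_arithmeticSubgroup_of_isCompact hC 1 1
  -- `T(F) ↪ G(F)`
  have hι : Function.Injective fun t : rationalTorus F E c N =>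
      (⟨((t : torusAdelic F E c N) : (quasiSplit F E c N).Adelic), t.2⟩ :
        (quasiSplit F E c N).arithmeticSubgroup) := fun a a' h =>
    Subtype.ext (Subtype.ext (congrArg
      (fun z : (quasiSplit F E c N).arithmeticSubgroup => (z : (quasiSplit F E c N).Adelic)) h))
  refine (hfin.preimage hι.injOn).subset ?_
  rintro t ⟨x, hx, y, hy, m, hm⟩
  change (1 : (quasiSplit F E c N).Adelic)⁻¹ * ((t : torusAdelic F E c N) : (quasiSplit F E c N).Adelic) * 1 ∈
    (Subtype.val : borelAdelic F E c N → (quasiSplit F E c N).Adelic) ''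
      (torusPart '' ((Subtype.val : borelAdelic F E c N → (quasiSplit F E c N).Adelic) ⁻¹' K))
  rw [inv_one, one_mul, mul_one]
  have htB := torusAdelic_le_borelAdelic t.1.2
  have hbB : ((t : torusAdelic F E c N) : (quasiSplit F E c N).Adelic) *
      ((m : adelicUnipotent F E c N) : (quasiSplit F E c N).Adelic) ∈ borelAdelic F E c N :=
    Subgroup.mul_mem _ htB (adelicUnipotent_le_borelAdelic m.2)
  refine ⟨torusPart ⟨_, hbB⟩, ⟨⟨_, hbB⟩, ?_, rfl⟩, ?_⟩
  · -- `t m = x · (x⁻¹ (t m) y) · y⁻¹ ∈ K`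
    refine ⟨((x, y), x⁻¹ * (((t : torusAdelic F E c N) : (quasiSplit F E c N).Adelic) *
      ((m : adelicUnipotent F E c N) : (quasiSplit F E c N).Adelic)) * y),
      ⟨⟨hx, hy⟩, ?_⟩, ?_⟩
    · rw [← mul_assoc]
      exact hm
    · change x * (x⁻¹ * (((t : torusAdelic F E c N) : (quasiSplit F E c N).Adelic) *
          ((m : adelicUnipotent F E c N) : (quasiSplit F E c N).Adelic)) * y) * y⁻¹ = _
      rw [mul_assoc x, mul_inv_cancel_right, mul_inv_cancel_left]
  · rw [torusPart_mul_of_mem_torusAdelic_of_mem_adelicUnipotent t.1.2 m.2]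

/-! ## §5 The count on a Siegel set -/

section Three

variable [MeasurableSpace (adelicUnipotent F E c 3)] [BorelSpace (adelicUnipotent F E c 3)]

/-- **THE CELL COUNT ON A SIEGEL SET: `#R · ν(𝓕) ≤ C₀ · δ_B(b)`.** Let `ν` be a Haar measure of
`N(𝔸_F)` (`N = 3`), `𝓕` a fundamental domain of `N(F)` contained in a compact `W₀`, `U ⊆ N(𝔸_F)`,
`C, K, Ω ⊆ G(𝔸_F)` and `R₁, R₂ ⊆ 𝔸_E` compact. There is `C₀ : ℝ≥0` such that for every `b ∈ B(𝔸_F)` with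
unipotent part `(torusPart b)⁻¹ b ∈ Ω` and root values `d₀⁻¹ d₁ ∈ R₁`, `d₀⁻¹ d₂ ∈ R₂` (`d = diagUnit b`),
every `k ∈ K` and every finite `R ⊆ B(F)` whose elements `β` have `(b k)⁻¹ β (y · b k) ∈ C` for some
`y ∈ U`: `#R · ν(𝓕) ≤ C₀ · δ_B(b)`, `δ_B(b) = torusRootModulus E 3 (diagUnit b)`. Indeed
`#R · ν(𝓕) ≤ Σ'_t ν(A_t(b k) · U⁻¹ 𝓕)` (★ `card_mul_measure_le_tsum_measure`)
`≤ δ_B(b) · Σ'_t ν(A_t(k) · b⁻¹ (U⁻¹ 𝓕) b)` (★ `measure_cellSet_borel_mul_le`), and `A_t(k) ⊆ B_t =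
N(𝔸_F) ∩ t⁻¹ K C K⁻¹` (compact; `A_t(k)` is empty off the finite set `S` of §4), `b⁻¹ (U⁻¹ 𝓕) b ⊆ W'` (§3),
so the sum is at most `C₀ := Σ_{t ∈ S} ν(B_t · W') < ∞` (Rogawski (1990), §2.2 p. 13; Arthur (1978),
§5: the `O(δ_B)` count on a Siegel set). [cite: Rogawski1990, §2.2 (p. 13)] -/
theorem exists_forall_card_mul_measure_le_mul_torusRootModulus (hc : c * c = 1) (hc1 : c ≠ 1)
    (ν : Measure (adelicUnipotent F E c 3)) [ν.IsHaarMeasure]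
    {𝓕 : Set (adelicUnipotent F E c 3)} (h𝓕 : IsFundamentalDomain (rationalUnipotent F E c 3) 𝓕 ν)
    {W₀ : Set (adelicUnipotent F E c 3)} (hW₀ : IsCompact W₀) (h𝓕W₀ : 𝓕 ⊆ W₀)
    {U : Set (adelicUnipotent F E c 3)} (hU : IsCompact U)
    {C : Set (quasiSplit F E c 3).Adelic} (hC : IsCompact C)
    {K : Set (quasiSplit F E c 3).Adelic} (hK : IsCompact K)
    {Ω : Set (quasiSplit F E c 3).Adelic} (hΩ : IsCompact Ω)
    {R₁ R₂ : Set (AdeleRing (𝓞 E) E)} (hR₁ : IsCompact R₁) (hR₂ : IsCompact R₂) :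
    ∃ C₀ : ℝ≥0, ∀ b : borelAdelic F E c 3,
      (((torusPart b)⁻¹ * b : borelAdelic F E c 3) : (quasiSplit F E c 3).Adelic) ∈ Ω →
      (((diagUnit b.2 0)⁻¹ * diagUnit b.2 1 : (AdeleRing (𝓞 E) E)ˣ) : AdeleRing (𝓞 E) E) ∈ R₁ →
      (((diagUnit b.2 0)⁻¹ * diagUnit b.2 2 : (AdeleRing (𝓞 E) E)ˣ) : AdeleRing (𝓞 E) E) ∈ R₂ →
      ∀ k ∈ K, ∀ R : Finset (arithmeticBorel F E c 3),
        (∀ β ∈ R, ∃ y ∈ U, ((b : (quasiSplit F E c 3).Adelic) * k)⁻¹ *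
          (((β : (quasiSplit F E c 3).arithmeticSubgroup)) : (quasiSplit F E c 3).Adelic) *
          ((y : (quasiSplit F E c 3).Adelic) * ((b : (quasiSplit F E c 3).Adelic) * k)) ∈ C) →
        (R.card : ℝ≥0∞) * ν 𝓕 ≤ (C₀ : ℝ≥0∞) * ((torusRootModulus E 3 (diagUnit b.2) : ℝ≥0) : ℝ≥0∞) := by
  classical
  -- `W := U⁻¹ 𝓕 ⊆ Wc := U⁻¹ W₀` compact
  set Wc : Set (adelicUnipotent F E c 3) :=
    (fun p : adelicUnipotent F E c 3 × adelicUnipotent F E c 3 => p.1⁻¹ * p.2) '' (U ×ˢ W₀) with hWc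
  have hWcc : IsCompact Wc := (hU.prod hW₀).image (continuous_fst.inv.mul continuous_snd)
  have hWsub : U⁻¹ * 𝓕 ⊆ Wc := by
    rintro _ ⟨v, hv, m, hm, rfl⟩
    exact ⟨(v⁻¹, m), Set.mk_mem_prod (Set.mem_inv.1 hv) (h𝓕W₀ hm), by simp⟩
  -- `b⁻¹ Wc b ⊆ W'` compact (§3)
  obtain ⟨W', hW'c, hW'⟩ := exists_isCompact_borelConj_image_subset hc hWcc hΩ hR₁ hR₂
  -- the finite set `S` of torus fibres meeting `K C K⁻¹` (§4)
  have hSfin := finite_setOf_rationalTorus_conj_mem_of_isCompact (N := 3) hC hK hK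
  set S : Finset (rationalTorus F E c 3) := hSfin.toFinset with hS
  -- compact cells `B_t = N(𝔸_F) ∩ t⁻¹ K C K⁻¹ ⊇ A_t(k)` for all `k ∈ K`
  set Bt : rationalTorus F E c 3 → Set (adelicUnipotent F E c 3) := fun t =>
    (fun m : adelicUnipotent F E c 3 => (m : (quasiSplit F E c 3).Adelic)) ⁻¹'
      ((fun p : (quasiSplit F E c 3).Adelic × (quasiSplit F E c 3).Adelic =>
        (((t : torusAdelic F E c 3) : (quasiSplit F E c 3).Adelic))⁻¹ * (p.1 * p.2 * p.1⁻¹)) '' (K ×ˢ C))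
    with hBt
  have hBtc : ∀ t, IsCompact (Bt t) := fun t =>
    isCompact_preimage_coe_adelicUnipotent
      ((hK.prod hC).image (continuous_const.mul ((continuous_fst.mul continuous_snd).mul continuous_fst.inv)))
  have hfin : ∀ t, ν (Bt t * W') ≠ ∞ := fun t => by
    rw [← Set.image_mul_prod]
    exact (((hBtc t).prod hW'c).image continuous_mul).measure_lt_top.ne
  refine ⟨(∑ t ∈ S, ν (Bt t * W')).toNNReal, fun b hΩb h₁ h₂ k hk R hR => ?_⟩
  have hC₀ : (((∑ t ∈ S, ν (Bt t * W')).toNNReal : ℝ≥0) : ℝ≥0∞) = ∑ t ∈ S, ν (Bt t * W') :=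
    ENNReal.coe_toNNReal (ENNReal.sum_ne_top.2 fun t _ => hfin t)
  rw [hC₀]
  -- the conjugation `α = (w ↦ b⁻¹ w b)` and the cells `A_t(k)`
  set α : adelicUnipotent F E c 3 → adelicUnipotent F E c 3 := fun w =>
    ⟨(b : (quasiSplit F E c 3).Adelic)⁻¹ * (w : (quasiSplit F E c 3).Adelic) * (b : (quasiSplit F E c 3).Adelic),
      conj_mem_adelicUnipotent b.2 w.2⟩ with hα
  have hαW : α '' (U⁻¹ * 𝓕) ⊆ W' := (Set.image_mono hWsub).trans (hW' b hΩb h₁ h₂)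
  set A : rationalTorus F E c 3 → Set (adelicUnipotent F E c 3) := fun t =>
    {m : adelicUnipotent F E c 3 | k⁻¹ * ((t : torusAdelic F E c 3) : (quasiSplit F E c 3).Adelic) *
      ((m : adelicUnipotent F E c 3) : (quasiSplit F E c 3).Adelic) * k ∈ C} with hA
  have hAB : ∀ t, A t ⊆ Bt t := by
    intro t m hm
    refine ⟨(k, k⁻¹ * ((t : torusAdelic F E c 3) : (quasiSplit F E c 3).Adelic) *
      ((m : adelicUnipotent F E c 3) : (quasiSplit F E c 3).Adelic) * k), Set.mk_mem_prod hk hm, ?_⟩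
    change (((t : torusAdelic F E c 3) : (quasiSplit F E c 3).Adelic))⁻¹ *
        (k * (k⁻¹ * ((t : torusAdelic F E c 3) : (quasiSplit F E c 3).Adelic) *
          ((m : adelicUnipotent F E c 3) : (quasiSplit F E c 3).Adelic) * k) * k⁻¹) =
      ((m : adelicUnipotent F E c 3) : (quasiSplit F E c 3).Adelic)
    group
  have hA0 : ∀ t ∉ S, A t = ∅ := by
    intro t ht
    refine Set.eq_empty_iff_forall_notMem.2 fun m hm => ht ?_
    rw [hS, Set.Finite.mem_toFinset]
    exact ⟨k, hk, k, hk, m, hm⟩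
  have hterm : ∀ t, ν (A t * α '' (U⁻¹ * 𝓕)) ≤ ν (Bt t * W') := fun t =>
    measure_mono (Set.mul_subset_mul (hAB t) hαW)
  calc (R.card : ℝ≥0∞) * ν 𝓕
      ≤ ∑' t : rationalTorus F E c 3,
          ν ({m : adelicUnipotent F E c 3 | ((b : (quasiSplit F E c 3).Adelic) * k)⁻¹ *
              ((t : torusAdelic F E c 3) : (quasiSplit F E c 3).Adelic) *
              ((m : adelicUnipotent F E c 3) : (quasiSplit F E c 3).Adelic) *
              ((b : (quasiSplit F E c 3).Adelic) * k) ∈ C} * (U⁻¹ * 𝓕)) :=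
        card_mul_measure_le_tsum_measure ν h𝓕 ((b : (quasiSplit F E c 3).Adelic) * k) C U R hR
    _ ≤ ∑' t : rationalTorus F E c 3,
          ((torusRootModulus E 3 (diagUnit b.2) : ℝ≥0) : ℝ≥0∞) * ν (A t * α '' (U⁻¹ * 𝓕)) :=
        ENNReal.tsum_le_tsum fun t => measure_cellSet_borel_mul_le hc hc1 ν b k C (U⁻¹ * 𝓕) t
    _ = ((torusRootModulus E 3 (diagUnit b.2) : ℝ≥0) : ℝ≥0∞) *
          ∑' t : rationalTorus F E c 3, ν (A t * α '' (U⁻¹ * 𝓕)) :=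
        ENNReal.tsum_mul_left
    _ = ((torusRootModulus E 3 (diagUnit b.2) : ℝ≥0) : ℝ≥0∞) *
          ∑ t ∈ S, ν (A t * α '' (U⁻¹ * 𝓕)) := by
        rw [tsum_eq_sum (s := S) fun t ht => by rw [hA0 t ht, Set.empty_mul, measure_empty]]
    _ ≤ ((torusRootModulus E 3 (diagUnit b.2) : ℝ≥0) : ℝ≥0∞) * ∑ t ∈ S, ν (Bt t * W') :=
        mul_le_mul' le_rfl (Finset.sum_le_sum fun t _ => hterm t)
    _ = (∑ t ∈ S, ν (Bt t * W')) * ((torusRootModulus E 3 (diagUnit b.2) : ℝ≥0) : ℝ≥0∞) :=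
        mul_comm _ _

end Three

end UnitaryGroup

end Literature.NumberTheory.Automorphic
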